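import Mathlib
import Literature.Analysis.Convexity.CavalieriSlices
import Literature.Barriers.AtomisticToContinuum.TetrahedralFrustrationRogers
import HarnessLib

/-!
# Plane sections of a tetrahedron: the `λ`-chart and the quadratic-spline slice areas

Topic `Literature/Analysis/Convexity`; namespace `Literature.Analysis.Convexity`.  Companion of
`CavalieriSlices.lean` (coarea for affine maps, chart language) and of the simplices
`rogersSimplex v c = {v + s₀c₀ + s₁c₁ + s₂c₂ : sᵢ ≥ 0, Σ sᵢ ≤ 1}` of
`Literature/Barriers/AtomisticToContinuum/TetrahedralFrustrationRogers.lean`.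

For `g ≠ 0`, `f = ⟪g, ·⟫ + κ`, an orthonormal pair `U, V ⊥ g`, the slice of a set `S` at level `t`
is read in the isometric chart `y ↦ ((t − κ)/‖g‖²) g + y₁ U + y₂ V` of the plane `{f = t}` (as in
`lintegral_volume_chartSlice_levelSet`).  For a tetrahedron `rogersSimplex v c` with
`δᵢ = ⟪g, cᵢ⟫ = f(v + cᵢ) − f(v)` and `δ₂ ≠ 0`, solving `f = t` for the third parameter gives

* `chartSlice_rogersSimplex_eq` — **the `λ`-chart**: the chart slice at level `t` is the image of the
  planar region `sliceRegion (f v) δ₀ δ₁ δ₂ t = {s₀, s₁ ≥ 0, s₂(s,t) ≥ 0, s₀ + s₁ + s₂(s,t) ≤ 1}`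
  under an affine map of `ℝ × ℝ` whose linear part `sliceMap` does not depend on `t`; hence
* `volume_chartSlice_rogersSimplex` — `area(slice at t) = |det sliceMap| · area(sliceRegion … t)`:
  the slice area is, up to a constant of the cell, the area of an explicit polygon with `t`-affine
  sides — a polynomial of degree `≤ 2` on every interval between consecutive vertex values
  (Curry–Schoenberg: plane sections of an `n`-simplex are B-splines of degree `n − 1` with knots at
  the vertex values);
* the areas of the regions for the vertex-value classes of a `{0, ½, 1}`-valued interpolant
  (`volume_sliceRegion_cone`, `…_rect`, `…_trapezoid…`): `½(1−r)²`, `r(1−r)`, `t − (3/2)t²`, …,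
  and re-rooting lemmas `rogersSimplex_reroot`, `rogersSimplex_swap01`, `rogersSimplex_swap12`
  to place the apex of a given cell at the vertex a class lemma wants;
* the integrals of these areas over the level (`lintegral_volume_sliceRegion_cone/_rect` `= |d|/6`,
  `…_trapezoid/_mirror = 1/12`), which together with `lintegral_volume_chartSlice_levelSet`
  (`∫ A(t) dt = ‖g‖·|cell|`) identify the cell constant: `|sliceDet| · ∫ area = ‖g‖ · |cell|` — so a
  consumer never computes `sliceDet`.  Composite Simpson on `{0, ¼, ½, ¾, 1}` is then exact cell by
  cell (the areas are quadratic on `[0, ½]` and on `[½, 1]`);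
* per-class quadrature identities (`radau_sliceRegion_*`, `simpson_sliceRegion_*`) and the
  H-description `rogersSimplex_eq_setOf_dual` of the closed simplex through a dual frame
  (`⟪wᵢ, cⱼ⟫ = δᵢⱼ`), the glue to cells presented as open H-polytopes.

[cite: CurrySchoenberg1966, §1 and §4 (the B-spline `M(x; x₀,…,xₙ)` as the `(n−1)`-volume of the
section of an `n`-simplex, «geometric interpretation»)]; [cite: CohenRiesenfeldElber2001, §11.1
«Higher-dimensional volumetric projections», Examples 11.1–11.3 and Fig. 11.3 (the tetrahedron:
triangle / quadrilateral / triangle sections, explicit quadratics)].  Consumed by the tent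
certificate of `Summits/Ventures/Crystal3D` (exact Simpson quadrature of level-set facet areas).
-/

noncomputable section

open MeasureTheory Set
open scoped RealInnerProductSpace ENNReal

namespace Literature.Analysis.Convexity

open Literature.Barriers.AtomisticToContinuum (rogersSimplex edgeMap paramSimplex edgeMap_apply)


/-! ## The simplex `rogersSimplex v c` with three real parameters; re-rooting -/

/-- `x ∈ rogersSimplex v c ↔ x = v + s₀c₀ + s₁c₁ + s₂c₂` with `sᵢ ≥ 0`, `s₀ + s₁ + s₂ ≤ 1`.
[cite: Rogers1964, Ch. 7 §2 (the simplices `c₀c₁c₂c₃`)] -/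
theorem mem_rogersSimplex_iff (v : EuclideanSpace ℝ (Fin 3)) (c : Fin 3 → EuclideanSpace ℝ (Fin 3)) (x : EuclideanSpace ℝ (Fin 3)) :
    x ∈ rogersSimplex v c ↔ ∃ s₀ s₁ s₂ : ℝ, 0 ≤ s₀ ∧ 0 ≤ s₁ ∧ 0 ≤ s₂ ∧ s₀ + s₁ + s₂ ≤ 1 ∧
      x = v + s₀ • c 0 + s₁ • c 1 + s₂ • c 2 := by
  unfold rogersSimplex paramSimplex
  simp only [Set.mem_image, Set.mem_setOf_eq, edgeMap_apply, Fin.sum_univ_three]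
  constructor
  · rintro ⟨t, ⟨ht0, ht1⟩, rfl⟩
    exact ⟨t 0, t 1, t 2, ht0 0, ht0 1, ht0 2, ht1, by abel⟩
  · rintro ⟨s₀, s₁, s₂, h0, h1, h2, hs, rfl⟩
    refine ⟨!₂[s₀, s₁, s₂], ⟨?_, ?_⟩, ?_⟩
    · intro i
      fin_cases i <;> simp [h0, h1, h2]
    · simpa using hs
    · simp only [Matrix.cons_val_zero, Matrix.cons_val_one, Matrix.cons_val]
      abel

/-- Swapping the first two edge vectors does not change the simplex.
[cite: Rogers1964, Ch. 7 §2] -/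
theorem rogersSimplex_swap01 (v : EuclideanSpace ℝ (Fin 3)) (c : Fin 3 → EuclideanSpace ℝ (Fin 3)) :
    rogersSimplex v ![c 1, c 0, c 2] = rogersSimplex v c := by
  ext x
  rw [mem_rogersSimplex_iff, mem_rogersSimplex_iff]
  simp only [Matrix.cons_val_zero, Matrix.cons_val_one, Matrix.cons_val]
  constructor
  · rintro ⟨s₀, s₁, s₂, h0, h1, h2, hs, rfl⟩
    exact ⟨s₁, s₀, s₂, h1, h0, h2, by linarith, by abel⟩
  · rintro ⟨s₀, s₁, s₂, h0, h1, h2, hs, rfl⟩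
    exact ⟨s₁, s₀, s₂, h1, h0, h2, by linarith, by abel⟩

/-- Swapping the last two edge vectors does not change the simplex.
[cite: Rogers1964, Ch. 7 §2] -/
theorem rogersSimplex_swap12 (v : EuclideanSpace ℝ (Fin 3)) (c : Fin 3 → EuclideanSpace ℝ (Fin 3)) :
    rogersSimplex v ![c 0, c 2, c 1] = rogersSimplex v c := by
  ext x
  rw [mem_rogersSimplex_iff, mem_rogersSimplex_iff]
  simp only [Matrix.cons_val_zero, Matrix.cons_val_one, Matrix.cons_val]
  constructor
  · rintro ⟨s₀, s₁, s₂, h0, h1, h2, hs, rfl⟩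
    exact ⟨s₀, s₂, s₁, h0, h2, h1, by linarith, by abel⟩
  · rintro ⟨s₀, s₁, s₂, h0, h1, h2, hs, rfl⟩
    exact ⟨s₀, s₂, s₁, h0, h2, h1, by linarith, by abel⟩

/-- **Re-rooting**: the same simplex with apex moved to the vertex `v + c₀`.
[cite: Rogers1964, Ch. 7 §2] -/
theorem rogersSimplex_reroot (v : EuclideanSpace ℝ (Fin 3)) (c : Fin 3 → EuclideanSpace ℝ (Fin 3)) :
    rogersSimplex (v + c 0) ![-c 0, c 1 - c 0, c 2 - c 0] = rogersSimplex v c := by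
  ext x
  rw [mem_rogersSimplex_iff, mem_rogersSimplex_iff]
  simp only [Matrix.cons_val_zero, Matrix.cons_val_one, Matrix.cons_val]
  constructor
  · rintro ⟨s₀, s₁, s₂, h0, h1, h2, hs, rfl⟩
    exact ⟨1 - s₀ - s₁ - s₂, s₁, s₂, by linarith, h1, h2, by linarith, by module⟩
  · rintro ⟨s₀, s₁, s₂, h0, h1, h2, hs, rfl⟩
    exact ⟨1 - s₀ - s₁ - s₂, s₁, s₂, by linarith, h1, h2, by linarith, by module⟩

/-! ## The `λ`-chart of a level slice -/

/-- The parameter region of the level-`t` slice of a simplex with apex value `h` and edge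
increments `δ₀, δ₁, δ₂` (`δ₂ ≠ 0`), the third parameter being solved from `f = t`:
`{(s₀, s₁) : s₀ ≥ 0, s₁ ≥ 0, s₂ ≥ 0, s₀ + s₁ + s₂ ≤ 1}` with `s₂ = (t − h − s₀δ₀ − s₁δ₁)/δ₂`.
[cite: CohenRiesenfeldElber2001, §11.1 (sections of a simplex)] -/
def sliceRegion (h δ₀ δ₁ δ₂ t : ℝ) : Set (ℝ × ℝ) :=
  {s | 0 ≤ s.1 ∧ 0 ≤ s.2 ∧ 0 ≤ (t - h - s.1 * δ₀ - s.2 * δ₁) / δ₂ ∧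
    s.1 + s.2 + (t - h - s.1 * δ₀ - s.2 * δ₁) / δ₂ ≤ 1}

/-- The linear part of the `λ`-chart: its columns are the chart coordinates of the two vectors
`c₀ − (δ₀/δ₂)c₂`, `c₁ − (δ₁/δ₂)c₂` of the plane `{⟪g,·⟫ = 0}`; it does not depend on the level.
[cite: CohenRiesenfeldElber2001, §11.1] -/
def sliceMap (g U V : EuclideanSpace ℝ (Fin 3)) (c : Fin 3 → EuclideanSpace ℝ (Fin 3)) : (ℝ × ℝ) →ₗ[ℝ] (ℝ × ℝ) :=
  Matrix.toLin (Module.Basis.finTwoProd ℝ) (Module.Basis.finTwoProd ℝ)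
    !![⟪c 0 - (⟪g, c 0⟫ / ⟪g, c 2⟫) • c 2, U⟫, ⟪c 1 - (⟪g, c 1⟫ / ⟪g, c 2⟫) • c 2, U⟫;
       ⟪c 0 - (⟪g, c 0⟫ / ⟪g, c 2⟫) • c 2, V⟫, ⟪c 1 - (⟪g, c 1⟫ / ⟪g, c 2⟫) • c 2, V⟫]

/-- The determinant of the `λ`-chart. [cite: CohenRiesenfeldElber2001, §11.1] -/
def sliceDet (g U V : EuclideanSpace ℝ (Fin 3)) (c : Fin 3 → EuclideanSpace ℝ (Fin 3)) : ℝ :=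
  ⟪c 0 - (⟪g, c 0⟫ / ⟪g, c 2⟫) • c 2, U⟫ * ⟪c 1 - (⟪g, c 1⟫ / ⟪g, c 2⟫) • c 2, V⟫ -
    ⟪c 1 - (⟪g, c 1⟫ / ⟪g, c 2⟫) • c 2, U⟫ * ⟪c 0 - (⟪g, c 0⟫ / ⟪g, c 2⟫) • c 2, V⟫

/-- The translation part of the `λ`-chart at level `t`: the chart coordinates of the point of the
edge line `v + ℝc₂` at level `t`. [cite: CohenRiesenfeldElber2001, §11.1] -/
def sliceShift (g U V : EuclideanSpace ℝ (Fin 3)) (κ : ℝ) (v : EuclideanSpace ℝ (Fin 3)) (c : Fin 3 → EuclideanSpace ℝ (Fin 3)) (t : ℝ) : ℝ × ℝ :=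
  (⟪v + ((t - κ - ⟪g, v⟫) / ⟪g, c 2⟫) • c 2, U⟫, ⟪v + ((t - κ - ⟪g, v⟫) / ⟪g, c 2⟫) • c 2, V⟫)

/-- the `λ`-chart's linear part in coordinates. [cite: CohenRiesenfeldElber2001, §11.1] -/
theorem sliceMap_apply (g U V : EuclideanSpace ℝ (Fin 3)) (c : Fin 3 → EuclideanSpace ℝ (Fin 3)) (s : ℝ × ℝ) :
    sliceMap g U V c s =
      (⟪c 0 - (⟪g, c 0⟫ / ⟪g, c 2⟫) • c 2, U⟫ * s.1 + ⟪c 1 - (⟪g, c 1⟫ / ⟪g, c 2⟫) • c 2, U⟫ * s.2,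
       ⟪c 0 - (⟪g, c 0⟫ / ⟪g, c 2⟫) • c 2, V⟫ * s.1 + ⟪c 1 - (⟪g, c 1⟫ / ⟪g, c 2⟫) • c 2, V⟫ * s.2) := by
  simp [sliceMap]

/-- its determinant. [cite: CohenRiesenfeldElber2001, §11.1] -/
theorem det_sliceMap (g U V : EuclideanSpace ℝ (Fin 3)) (c : Fin 3 → EuclideanSpace ℝ (Fin 3)) :
    LinearMap.det (sliceMap g U V c) = sliceDet g U V c := by
  rw [sliceMap, LinearMap.det_toLin, Matrix.det_fin_two_of, sliceDet]

/-! ### The set identity and the area formula -/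

section chart
variable {g U V : EuclideanSpace ℝ (Fin 3)}

/-- inner products with the chart base point `((t − κ)/‖g‖²) g`. [folklore] -/
private theorem inner_base (hg : g ≠ 0) (κ t : ℝ) : ⟪g, ((t - κ) / ‖g‖ ^ 2) • g⟫ = t - κ := by
  have hgn : ‖g‖ ≠ 0 := norm_ne_zero_iff.mpr hg
  rw [inner_smul_right, real_inner_self_eq_norm_sq]
  field_simp

/-- the chart base point is orthogonal to the chart directions. [folklore] -/
private theorem inner_base_U (hgU : ⟪g, U⟫ = 0) (κ t : ℝ) :
    ⟪((t - κ) / ‖g‖ ^ 2) • g, U⟫ = 0 := by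
  rw [inner_smul_left, hgU]; simp

/-- a vector orthogonal to `g` with prescribed `U`- and `V`-coordinates is `y₁ U + y₂ V`. [folklore] -/
private theorem eq_of_frame (hg : g ≠ 0) (hU : ‖U‖ = 1) (hV : ‖V‖ = 1) (hUV : ⟪U, V⟫ = 0)
    (hgU : ⟪g, U⟫ = 0) (hgV : ⟪g, V⟫ = 0) {z : EuclideanSpace ℝ (Fin 3)} {y₁ y₂ : ℝ} (hzU : ⟪z, U⟫ = y₁)
    (hzV : ⟪z, V⟫ = y₂) (hzg : ⟪g, z⟫ = 0) : z = y₁ • U + y₂ • V := by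
  have hgn : 0 < ‖g‖ := norm_pos_iff.mpr hg
  set a : EuclideanSpace ℝ (Fin 3) := ‖g‖⁻¹ • g with ha_def
  have ha : ‖a‖ = 1 := by
    rw [ha_def, norm_smul, norm_inv, norm_norm, inv_mul_cancel₀ hgn.ne']
  have haU : ⟪a, U⟫ = 0 := by rw [ha_def, inner_smul_left, hgU]; simp
  have haV : ⟪a, V⟫ = 0 := by rw [ha_def, inner_smul_left, hgV]; simp
  have haz : ⟪a, z⟫ = 0 := by rw [ha_def, inner_smul_left, hzg]; simp
  have h := frame_expansion_three ha hU hV hUV haU haV z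
  rw [real_inner_comm z U, real_inner_comm z V, hzU, hzV, haz, zero_smul, add_zero] at h
  exact h.symm

/-- **The `λ`-chart of a level slice of a tetrahedron.**  For `f = ⟪g,·⟫ + κ` (`g ≠ 0`), an
orthonormal pair `U, V ⊥ g` and a simplex `rogersSimplex v c` with `⟪g, c₂⟫ ≠ 0`, the chart slice
`{y | ((t−κ)/‖g‖²)g + y₁U + y₂V ∈ rogersSimplex v c}` at level `t` is the image of the planar region
`sliceRegion (f v) δ₀ δ₁ δ₂ t` (`δᵢ = ⟪g, cᵢ⟫`) under the affine map `s ↦ sliceMap s + sliceShift t`,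
whose linear part does not depend on `t`.
[cite: CohenRiesenfeldElber2001, §11.1 Examples 11.1–11.2 (sections of a simplex computed in the
parameters of the simplex)]; [cite: CurrySchoenberg1966, §4 (geometric interpretation of the B-spline)] -/
theorem chartSlice_rogersSimplex_eq (hg : g ≠ 0) (hU : ‖U‖ = 1) (hV : ‖V‖ = 1) (hUV : ⟪U, V⟫ = 0)
    (hgU : ⟪g, U⟫ = 0) (hgV : ⟪g, V⟫ = 0) (κ : ℝ) (v : EuclideanSpace ℝ (Fin 3)) (c : Fin 3 → EuclideanSpace ℝ (Fin 3)) (hδ : ⟪g, c 2⟫ ≠ 0)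
    (t : ℝ) :
    {y : ℝ × ℝ | ((t - κ) / ‖g‖ ^ 2) • g + y.1 • U + y.2 • V ∈ rogersSimplex v c} =
      (fun s => sliceMap g U V c s + sliceShift g U V κ v c t) ''
        sliceRegion (⟪g, v⟫ + κ) ⟪g, c 0⟫ ⟪g, c 1⟫ ⟪g, c 2⟫ t := by
  -- abbreviations
  set δ₀ := ⟪g, c 0⟫ with hδ₀
  set δ₁ := ⟪g, c 1⟫ with hδ₁
  set δ₂ := ⟪g, c 2⟫ with hδ₂
  set b : EuclideanSpace ℝ (Fin 3) := ((t - κ) / ‖g‖ ^ 2) • g with hb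
  -- the third parameter solved from `f = t`
  set σ : ℝ × ℝ → ℝ := fun s => (t - (⟪g, v⟫ + κ) - s.1 * δ₀ - s.2 * δ₁) / δ₂ with hσ
  -- the point of the simplex with parameters `(s₀, s₁, σ s)`
  set X : ℝ × ℝ → EuclideanSpace ℝ (Fin 3) := fun s => v + s.1 • c 0 + s.2 • c 1 + σ s • c 2 with hX
  have hσδ : ∀ s : ℝ × ℝ, σ s * δ₂ = t - (⟪g, v⟫ + κ) - s.1 * δ₀ - s.2 * δ₁ := by
    intro s; rw [hσ]; exact div_mul_cancel₀ _ hδ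
  -- (K1) `f (X s) = t`
  have hK1 : ∀ s : ℝ × ℝ, ⟪g, X s⟫ = t - κ := by
    intro s
    simp only [hX, inner_add_right, inner_smul_right]
    rw [← hδ₀, ← hδ₁, ← hδ₂]
    have := hσδ s
    nlinarith [this]
  -- (K2)/(K3) the chart coordinates of `X s`
  have hUU : ⟪U, U⟫ = 1 := by rw [real_inner_self_eq_norm_sq, hU, one_pow]
  have hVV : ⟪V, V⟫ = 1 := by rw [real_inner_self_eq_norm_sq, hV, one_pow]
  have hVU : ⟪V, U⟫ = 0 := by rw [real_inner_comm]; exact hUV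
  have hK2 : ∀ s : ℝ × ℝ, ⟪X s, U⟫ = (sliceMap g U V c s + sliceShift g U V κ v c t).1 := by
    intro s
    rw [sliceMap_apply, sliceShift, Prod.fst_add]
    simp only [hX, inner_add_left, inner_smul_left, inner_sub_left, RCLike.conj_to_real]
    rw [← hδ₀, ← hδ₁, ← hδ₂, hσ]
    field_simp
    ring
  have hK3 : ∀ s : ℝ × ℝ, ⟪X s, V⟫ = (sliceMap g U V c s + sliceShift g U V κ v c t).2 := by
    intro s
    rw [sliceMap_apply, sliceShift, Prod.snd_add]
    simp only [hX, inner_add_left, inner_smul_left, inner_sub_left, RCLike.conj_to_real]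
    rw [← hδ₀, ← hδ₁, ← hδ₂, hσ]
    field_simp
    ring
  ext y
  simp only [Set.mem_setOf_eq, Set.mem_image]
  constructor
  · -- (⊆)
    intro hy
    obtain ⟨s₀, s₁, s₂, h0, h1, h2, hs, hP⟩ := (mem_rogersSimplex_iff v c _).mp hy
    -- apply `⟪g, ·⟫` to `hP`
    have hgP : t - κ = ⟪g, v⟫ + s₀ * δ₀ + s₁ * δ₁ + s₂ * δ₂ := by
      have := congrArg (fun z => ⟪g, z⟫) hP
      simp only [inner_add_right, inner_smul_right] at this
      rw [inner_base hg, hgU, hgV, mul_zero, mul_zero, add_zero, add_zero] at this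
      rw [this, hδ₀, hδ₁, hδ₂]
    have hs₂ : s₂ = σ (s₀, s₁) := by
      rw [hσ]
      field_simp
      linarith
    refine ⟨(s₀, s₁), ⟨h0, h1, ?_, ?_⟩, ?_⟩
    · show 0 ≤ (t - (⟪g, v⟫ + κ) - (s₀, s₁).1 * δ₀ - (s₀, s₁).2 * δ₁) / δ₂
      have : (t - (⟪g, v⟫ + κ) - (s₀, s₁).1 * δ₀ - (s₀, s₁).2 * δ₁) / δ₂ = σ (s₀, s₁) := rfl
      rw [this, ← hs₂]; exact h2
    · show (s₀, s₁).1 + (s₀, s₁).2 + (t - (⟪g, v⟫ + κ) - (s₀, s₁).1 * δ₀ - (s₀, s₁).2 * δ₁) / δ₂ ≤ 1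
      have : (t - (⟪g, v⟫ + κ) - (s₀, s₁).1 * δ₀ - (s₀, s₁).2 * δ₁) / δ₂ = σ (s₀, s₁) := rfl
      rw [this, ← hs₂]; exact hs
    · have hXP : X (s₀, s₁) = b + y.1 • U + y.2 • V := by
        rw [hP, hX, hs₂]
      have h1' : y.1 = ⟪X (s₀, s₁), U⟫ := by
        rw [hXP]
        simp only [inner_add_left, inner_smul_left, RCLike.conj_to_real]
        rw [inner_base_U hgU, hUU, hVU]; ring
      have h2' : y.2 = ⟪X (s₀, s₁), V⟫ := by
        rw [hXP]
        simp only [inner_add_left, inner_smul_left, RCLike.conj_to_real]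
        rw [inner_base_U hgV, hUV, hVV]; ring
      rw [hK2] at h1'
      rw [hK3] at h2'
      exact Prod.ext h1'.symm h2'.symm
  · -- (⊇)
    rintro ⟨s, ⟨h0, h1, h2, hs⟩, rfl⟩
    have hmem : X s ∈ rogersSimplex v c :=
      (mem_rogersSimplex_iff v c _).mpr ⟨s.1, s.2, σ s, h0, h1, h2, hs, rfl⟩
    have hz : X s - b = (sliceMap g U V c s + sliceShift g U V κ v c t).1 • U +
        (sliceMap g U V c s + sliceShift g U V κ v c t).2 • V := by
      refine eq_of_frame hg hU hV hUV hgU hgV ?_ ?_ ?_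
      · rw [inner_sub_left, inner_base_U hgU, sub_zero, hK2]
      · rw [inner_sub_left, inner_base_U hgV, sub_zero, hK3]
      · rw [inner_sub_right, hK1, inner_base hg, sub_self]
    have : b + (sliceMap g U V c s + sliceShift g U V κ v c t).1 • U +
        (sliceMap g U V c s + sliceShift g U V κ v c t).2 • V = X s := by
      rw [add_assoc, ← hz]; abel
    rw [this]
    exact hmem

/-- **Slice area = `|det| ×` area of the parameter region.**  With the notation of
`chartSlice_rogersSimplex_eq`: the chart area of the level-`t` slice of `rogersSimplex v c` equals
`|sliceDet| · area(sliceRegion (f v) δ₀ δ₁ δ₂ t)` — in particular it is a polynomial of degree `≤ 2`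
in `t` on every interval between consecutive vertex values, the region being a polygon with
`t`-affine sides (Curry–Schoenberg).
[cite: CurrySchoenberg1966, §4]; [cite: CohenRiesenfeldElber2001, §11.1 Example 11.2, Fig. 11.3] -/
theorem volume_chartSlice_rogersSimplex (hg : g ≠ 0) (hU : ‖U‖ = 1) (hV : ‖V‖ = 1)
    (hUV : ⟪U, V⟫ = 0) (hgU : ⟪g, U⟫ = 0) (hgV : ⟪g, V⟫ = 0) (κ : ℝ) (v : EuclideanSpace ℝ (Fin 3)) (c : Fin 3 → EuclideanSpace ℝ (Fin 3))
    (hδ : ⟪g, c 2⟫ ≠ 0) (t : ℝ) :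
    volume {y : ℝ × ℝ | ((t - κ) / ‖g‖ ^ 2) • g + y.1 • U + y.2 • V ∈ rogersSimplex v c} =
      ENNReal.ofReal |sliceDet g U V c| *
        volume (sliceRegion (⟪g, v⟫ + κ) ⟪g, c 0⟫ ⟪g, c 1⟫ ⟪g, c 2⟫ t) := by
  rw [chartSlice_rogersSimplex_eq hg hU hV hUV hgU hgV κ v c hδ t]
  have himg : (fun s => sliceMap g U V c s + sliceShift g U V κ v c t) ''
      sliceRegion (⟪g, v⟫ + κ) ⟪g, c 0⟫ ⟪g, c 1⟫ ⟪g, c 2⟫ t =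
      (fun x => x + -sliceShift g U V κ v c t) ⁻¹'
        (sliceMap g U V c '' sliceRegion (⟪g, v⟫ + κ) ⟪g, c 0⟫ ⟪g, c 1⟫ ⟪g, c 2⟫ t) := by
    ext x
    simp only [Set.mem_image, Set.mem_preimage]
    constructor
    · rintro ⟨s, hs, rfl⟩
      exact ⟨s, hs, by abel⟩
    · rintro ⟨s, hs, h⟩
      exact ⟨s, hs, by rw [h]; abel⟩
  rw [himg, measure_preimage_add_right, Measure.addHaar_image_linearMap, det_sliceMap]

end chart

/-! ## Areas of the parameter regions for the vertex-value classes

For an interpolant with vertex values in `{0, ½, 1}` the data `(h; δ₀, δ₁, δ₂)` of a cell, after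
re-rooting, is one of: `(h; 0, 0, d)` (three equal values at the apex and two edges — classes
`{0,0,0,1}`, `{0,1,1,1}`, `{½;0,0,0}`, `{½;1,1,1}`), `(h; 0, d, d)` (class `{0,0,1,1}`), or
`(0; 1, 0, ½)` / `(1; −1, 0, −½)` (the corner classes `{½; 0,0,1}`, `{½; 0,1,1}` — the only ones with
a trapezoid regime).  [cite: CohenRiesenfeldElber2001, §11.1 Example 11.2 (triangle and
trapezoid-plus-triangle sections), Example 11.3 (multiple knots)] -/

/-- volume of the region under a graph over a set, closed version (boundaries are null). [folklore] -/
private theorem volume_regionIcc {s : Set ℝ} (hs : MeasurableSet s) {f g : ℝ → ℝ}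
    (hf : Measurable f) (hg : Measurable g) :
    volume {p : ℝ × ℝ | p.1 ∈ s ∧ p.2 ∈ Icc (f p.1) (g p.1)} =
      ∫⁻ x in s, ENNReal.ofReal (g x - f x) := by
  rw [Measure.volume_eq_prod, Measure.prod_apply (measurableSet_region_between_cc hf hg hs)]
  have h : ∀ x : ℝ, (volume : Measure ℝ)
      (Prod.mk x ⁻¹' {p : ℝ × ℝ | p.1 ∈ s ∧ p.2 ∈ Icc (f p.1) (g p.1)}) =
      s.indicator (fun x => ENNReal.ofReal (g x - f x)) x := by
    intro x
    by_cases hx : x ∈ s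
    · have : Prod.mk x ⁻¹' {p : ℝ × ℝ | p.1 ∈ s ∧ p.2 ∈ Icc (f p.1) (g p.1)} = Icc (f x) (g x) := by
        ext y; simp [hx]
      rw [this, Real.volume_Icc, indicator_of_mem hx]
    · have : Prod.mk x ⁻¹' {p : ℝ × ℝ | p.1 ∈ s ∧ p.2 ∈ Icc (f p.1) (g p.1)} = ∅ := by
        ext y; simp [hx]
      rw [this, measure_empty, indicator_of_notMem hx]
  simp_rw [h]
  rw [lintegral_indicator hs]

/-- `∫_{[a,b]} (α + β x) dx` for `a ≤ b`. [folklore] -/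
private theorem setIntegral_Icc_affine {a b : ℝ} (hab : a ≤ b) (α β : ℝ) :
    ∫ x in Icc a b, (α + β * x) = α * (b - a) + β * ((b ^ 2 - a ^ 2) / 2) := by
  rw [integral_Icc_eq_integral_Ioc, ← intervalIntegral.integral_of_le hab,
    intervalIntegral.integral_add intervalIntegrable_const
      (intervalIntegral.intervalIntegrable_id.const_mul β),
    intervalIntegral.integral_const, intervalIntegral.integral_const_mul, integral_id]
  simp only [smul_eq_mul]
  ring

/-- volume of `{p | p.1 ∈ [a, b], p.2 ∈ [0, α + β p.1]}` when the fibre bound is nonnegative. [folklore] -/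
private theorem volume_underLine {a b α β : ℝ} (hab : a ≤ b)
    (hnn : ∀ x ∈ Icc a b, 0 ≤ α + β * x) :
    volume {p : ℝ × ℝ | p.1 ∈ Icc a b ∧ p.2 ∈ Icc 0 (α + β * p.1)} =
      ENNReal.ofReal (α * (b - a) + β * ((b ^ 2 - a ^ 2) / 2)) := by
  have h := volume_regionIcc (s := Icc a b) measurableSet_Icc (f := fun _ => (0 : ℝ))
    (g := fun x => α + β * x) measurable_const (by fun_prop)
  simp only [sub_zero] at h
  rw [h, ← setIntegral_Icc_affine hab α β, ← ofReal_integral_eq_lintegral_ofReal]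
  · exact Continuous.integrableOn_Icc (by fun_prop)
  · exact (ae_restrict_iff' measurableSet_Icc).mpr (Filter.Eventually.of_forall fun x hx => hnn x hx)

/-- **Cone class** `(h; 0, 0, d)`: with `r = (t − h)/d ∈ [0, 1]` the region is the triangle
`{s ≥ 0, s₀ + s₁ ≤ 1 − r}` of area `(1 − r)²/2`.
[cite: CohenRiesenfeldElber2001, §11.1 Example 11.2 (triangular sections `x₀ < x < x₁`)] -/
theorem volume_sliceRegion_cone (h d t : ℝ) (hr0 : 0 ≤ (t - h) / d) (hr1 : (t - h) / d ≤ 1) :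
    volume (sliceRegion h 0 0 d t) = ENNReal.ofReal ((1 - (t - h) / d) ^ 2 / 2) := by
  set r := (t - h) / d with hr
  have hset : sliceRegion h 0 0 d t =
      {p : ℝ × ℝ | p.1 ∈ Icc 0 (1 - r) ∧ p.2 ∈ Icc 0 ((1 - r) + (-1) * p.1)} := by
    ext p
    simp only [sliceRegion, mul_zero, sub_zero, mem_setOf_eq, mem_Icc, ← hr]
    constructor
    · rintro ⟨h0, h1, -, hs⟩
      exact ⟨⟨h0, by linarith⟩, h1, by linarith⟩
    · rintro ⟨⟨h0, h0'⟩, h1, h1'⟩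
      exact ⟨h0, h1, hr0, by linarith⟩
  rw [hset, volume_underLine (by linarith) (fun x hx => by simp only [mem_Icc] at hx; linarith)]
  congr 1
  ring

/-- Cone class, empty regimes: `r < 0` or `r > 1`. [cite: CohenRiesenfeldElber2001, §11.1 Ex. 11.2] -/
theorem volume_sliceRegion_cone_eq_zero (h d t : ℝ) (hr : (t - h) / d < 0 ∨ 1 < (t - h) / d) :
    volume (sliceRegion h 0 0 d t) = 0 := by
  have : sliceRegion h 0 0 d t = ∅ := by
    ext p
    simp only [sliceRegion, mul_zero, sub_zero, mem_setOf_eq, mem_empty_iff_false, iff_false]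
    rintro ⟨h0, h1, h2, hs⟩
    rcases hr with hr | hr <;> linarith
  rw [this, measure_empty]

/-- **Rectangle class** `(h; 0, d, d)` (`{0,0,1,1}`): with `r = (t − h)/d ∈ [0,1]` the region is
`[0, 1 − r] × [0, r]`, of area `r(1 − r)` (the section is a parallelogram).
[cite: CohenRiesenfeldElber2001, §11.1 Example 11.2 (quadrilateral sections, Fig. 11.3)] -/
theorem volume_sliceRegion_rect (h d t : ℝ) (hd : d ≠ 0) (hr1 : (t - h) / d ≤ 1) :
    volume (sliceRegion h 0 d d t) = ENNReal.ofReal ((1 - (t - h) / d) * ((t - h) / d)) := by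
  set r := (t - h) / d with hr
  have hthird : ∀ p : ℝ × ℝ, (t - h - p.1 * 0 - p.2 * d) / d = r - p.2 := by
    intro p; rw [hr]; field_simp; ring
  have hset : sliceRegion h 0 d d t = Icc 0 (1 - r) ×ˢ Icc 0 r := by
    ext p
    simp only [sliceRegion, hthird, mem_setOf_eq, mem_prod, mem_Icc]
    constructor
    · rintro ⟨h0, h1, h2, hs⟩; exact ⟨⟨h0, by linarith⟩, h1, by linarith⟩
    · rintro ⟨⟨h0, h0'⟩, h1, h1'⟩; exact ⟨h0, h1, by linarith, by linarith⟩
  rw [hset, Measure.volume_eq_prod, Measure.prod_prod, Real.volume_Icc, Real.volume_Icc, sub_zero,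
    sub_zero, ← ENNReal.ofReal_mul (by linarith)]

/-- Rectangle class, empty regimes. [cite: CohenRiesenfeldElber2001, §11.1 Ex. 11.2] -/
theorem volume_sliceRegion_rect_eq_zero (h d t : ℝ) (hd : d ≠ 0)
    (hr : (t - h) / d < 0 ∨ 1 < (t - h) / d) : volume (sliceRegion h 0 d d t) = 0 := by
  have hthird : ∀ p : ℝ × ℝ, (t - h - p.1 * 0 - p.2 * d) / d = (t - h) / d - p.2 := by
    intro p; field_simp; ring
  have : sliceRegion h 0 d d t = ∅ := by
    ext p
    simp only [sliceRegion, hthird, mem_setOf_eq, mem_empty_iff_false, iff_false]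
    rintro ⟨h0, h1, h2, hs⟩
    rcases hr with hr | hr <;> linarith
  rw [this, measure_empty]

/-- **Trapezoid class** `(0; 1, 0, ½)` (corner cell `{½; 0, 0, 1}` rooted at a `0`-vertex, first edge
to the `1`-vertex, third edge to the centre), lower regime `0 ≤ t ≤ ½`: the region is the trapezoid
`{0 ≤ s₀ ≤ t, 0 ≤ s₁ ≤ 1 − 2t + s₀}` of area `t − (3/2)t²`.
[cite: CohenRiesenfeldElber2001, §11.1 Example 11.2 (the regime `x₁ < x < x₂`: trapezoid `A₁` plus
triangle `A₂`)] -/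
theorem volume_sliceRegion_trapezoid_low (t : ℝ) (ht0 : 0 ≤ t) (ht : t ≤ 1 / 2) :
    volume (sliceRegion 0 1 0 (1 / 2) t) = ENNReal.ofReal (t - 3 / 2 * t ^ 2) := by
  have hthird : ∀ p : ℝ × ℝ, (t - 0 - p.1 * 1 - p.2 * 0) / (1 / 2 : ℝ) = 2 * (t - p.1) := by
    intro p; field_simp; ring
  have hset : sliceRegion 0 1 0 (1 / 2) t =
      {p : ℝ × ℝ | p.1 ∈ Icc 0 t ∧ p.2 ∈ Icc 0 ((1 - 2 * t) + 1 * p.1)} := by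
    ext p
    simp only [sliceRegion, hthird, mem_setOf_eq, mem_Icc, one_mul]
    constructor
    · rintro ⟨h0, h1, h2, hs⟩; exact ⟨⟨h0, by linarith⟩, h1, by linarith⟩
    · rintro ⟨⟨h0, h0'⟩, h1, h1'⟩; exact ⟨h0, h1, by linarith, by linarith⟩
  rw [hset, volume_underLine ht0 (fun x hx => by simp only [mem_Icc] at hx; linarith)]
  congr 1; ring

/-- Trapezoid class, upper regime `½ ≤ t ≤ 1`: the region is the triangle
`{2t − 1 ≤ s₀ ≤ t, 0 ≤ s₁ ≤ 1 − 2t + s₀}` of area `(1 − t)²/2`.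
[cite: CohenRiesenfeldElber2001, §11.1 Example 11.2] -/
theorem volume_sliceRegion_trapezoid_high (t : ℝ) (ht : 1 / 2 ≤ t) (ht1 : t ≤ 1) :
    volume (sliceRegion 0 1 0 (1 / 2) t) = ENNReal.ofReal ((1 - t) ^ 2 / 2) := by
  have hthird : ∀ p : ℝ × ℝ, (t - 0 - p.1 * 1 - p.2 * 0) / (1 / 2 : ℝ) = 2 * (t - p.1) := by
    intro p; field_simp; ring
  have hset : sliceRegion 0 1 0 (1 / 2) t =
      {p : ℝ × ℝ | p.1 ∈ Icc (2 * t - 1) t ∧ p.2 ∈ Icc 0 ((1 - 2 * t) + 1 * p.1)} := by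
    ext p
    simp only [sliceRegion, hthird, mem_setOf_eq, mem_Icc, one_mul]
    constructor
    · rintro ⟨h0, h1, h2, hs⟩; exact ⟨⟨by linarith, by linarith⟩, h1, by linarith⟩
    · rintro ⟨⟨h0, h0'⟩, h1, h1'⟩; exact ⟨by linarith, h1, by linarith, by linarith⟩
  rw [hset, volume_underLine (by linarith) (fun x hx => by simp only [mem_Icc] at hx; linarith)]
  congr 1; ring

/-- Trapezoid class, empty regimes `t < 0` or `t > 1`. [cite: CohenRiesenfeldElber2001, §11.1 Ex. 11.2] -/
theorem volume_sliceRegion_trapezoid_eq_zero (t : ℝ) (ht : t < 0 ∨ 1 < t) :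
    volume (sliceRegion 0 1 0 (1 / 2) t) = 0 := by
  have hthird : ∀ p : ℝ × ℝ, (t - 0 - p.1 * 1 - p.2 * 0) / (1 / 2 : ℝ) = 2 * (t - p.1) := by
    intro p; field_simp; ring
  have : sliceRegion 0 1 0 (1 / 2) t = ∅ := by
    ext p
    simp only [sliceRegion, hthird, mem_setOf_eq, mem_empty_iff_false, iff_false]
    rintro ⟨h0, h1, h2, hs⟩
    rcases ht with ht | ht <;> linarith
  rw [this, measure_empty]

/-- The mirror corner class `{½; 0, 1, 1}` rooted at a `1`-vertex (data `(1; −1, 0, −½)`) has the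
region of the class `(0; 1, 0, ½)` at the reflected level `1 − t`.
[cite: CohenRiesenfeldElber2001, §11.1 Example 11.2] -/
theorem sliceRegion_mirror (t : ℝ) :
    sliceRegion 1 (-1) 0 (-1 / 2) t = sliceRegion 0 1 0 (1 / 2) (1 - t) := by
  ext p
  have h1 : (t - 1 - p.1 * (-1) - p.2 * 0) / (-1 / 2 : ℝ) = 2 * (1 - t - p.1) := by
    field_simp; ring
  have h2 : (1 - t - 0 - p.1 * 1 - p.2 * 0) / (1 / 2 : ℝ) = 2 * (1 - t - p.1) := by
    field_simp; ring
  simp only [sliceRegion, mem_setOf_eq, h1, h2]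

/-! ## Integrals of the region areas over the level (to be matched with the coarea formula)

With `volume_chartSlice_rogersSimplex` and `lintegral_volume_chartSlice_levelSet`
(`∫ A(t) dt = ‖g‖·|cell|`), these identify the cell constant `|sliceDet|` without computing it:
`|sliceDet| · ∫ area(sliceRegion … t) dt = ‖g‖ · |cell|`.
[cite: CurrySchoenberg1966, §4 (∫ M = 1: the B-spline is a density)];
[cite: CohenRiesenfeldElber2001, §11.1] -/

/-- affine substitution on the line for the lower integral. [folklore] -/
private theorem lintegral_comp_sub_div (G : ℝ → ℝ≥0∞) (h d : ℝ) (hd : d ≠ 0) :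
    ∫⁻ t, G ((t - h) / d) = ENNReal.ofReal |d| * ∫⁻ r, G r := by
  have h1 : (fun t => G ((t - h) / d)) = fun t => (fun u => G (d⁻¹ * u)) (t - h) := by
    funext t; simp only [div_eq_inv_mul]
  rw [h1, lintegral_sub_right_eq_self (fun u => G (d⁻¹ * u)) h]
  calc ∫⁻ u, G (d⁻¹ * u) = ∫⁻ s, G s ∂(Measure.map (d⁻¹ * ·) volume) :=
        (lintegral_map_equiv G (Homeomorph.mulLeft₀ d⁻¹ (inv_ne_zero hd)).toMeasurableEquiv).symm
    _ = ENNReal.ofReal |d| * ∫⁻ s, G s := by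
        rw [Real.map_volume_mul_left (inv_ne_zero hd), lintegral_smul_measure, smul_eq_mul, inv_inv]

/-- `∫⁻` of an `ofReal`-valued function supported in `[0,1]` as an interval integral. [folklore] -/
private theorem lintegral_indicator_Icc01 (q : ℝ → ℝ) (hq : Continuous q) (hnn : ∀ r ∈ Icc (0:ℝ) 1, 0 ≤ q r) :
    ∫⁻ r, (Icc (0:ℝ) 1).indicator (fun r => ENNReal.ofReal (q r)) r =
      ENNReal.ofReal (∫ r in (0:ℝ)..1, q r) := by
  rw [lintegral_indicator measurableSet_Icc, intervalIntegral.integral_of_le zero_le_one,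
    ← integral_Icc_eq_integral_Ioc, ← ofReal_integral_eq_lintegral_ofReal]
  · exact Continuous.integrableOn_Icc hq
  · exact (ae_restrict_iff' measurableSet_Icc).mpr (Filter.Eventually.of_forall hnn)

/-- **Cone class, integrated over the level**: `∫ area(sliceRegion h 0 0 d t) dt = |d|/6`.
[cite: CohenRiesenfeldElber2001, §11.1 Example 11.2]; [cite: CurrySchoenberg1966, §4] -/
theorem lintegral_volume_sliceRegion_cone (h d : ℝ) (hd : d ≠ 0) :
    ∫⁻ t, volume (sliceRegion h 0 0 d t) = ENNReal.ofReal (|d| / 6) := by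
  set G : ℝ → ℝ≥0∞ := fun r => (Icc (0:ℝ) 1).indicator (fun r => ENNReal.ofReal ((1 - r) ^ 2 / 2)) r
    with hG
  have hF : (fun t => volume (sliceRegion h 0 0 d t)) = fun t => G ((t - h) / d) := by
    funext t
    simp only [hG, Set.indicator_apply, mem_Icc]
    split_ifs with hr
    · exact volume_sliceRegion_cone h d t hr.1 hr.2
    · rw [not_and_or, not_le, not_le] at hr
      exact volume_sliceRegion_cone_eq_zero h d t hr
  rw [hF, lintegral_comp_sub_div G h d hd, hG,
    lintegral_indicator_Icc01 (fun r => (1 - r) ^ 2 / 2) (by fun_prop) (fun r _ => by positivity)]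
  rw [← ENNReal.ofReal_mul (abs_nonneg d)]
  congr 1
  have : ∫ r in (0:ℝ)..1, (1 - r) ^ 2 / 2 = 1 / 6 := by
    have hsub := intervalIntegral.integral_comp_sub_left (fun r : ℝ => r ^ 2 / 2) (1 : ℝ) (a := 0) (b := 1)
    simp only [sub_zero, sub_self] at hsub
    rw [hsub, intervalIntegral.integral_div, integral_pow]
    norm_num
  rw [this]; ring

/-- **Rectangle class, integrated over the level**: `∫ area(sliceRegion h 0 d d t) dt = |d|/6`.
[cite: CohenRiesenfeldElber2001, §11.1 Example 11.2]; [cite: CurrySchoenberg1966, §4] -/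
theorem lintegral_volume_sliceRegion_rect (h d : ℝ) (hd : d ≠ 0) :
    ∫⁻ t, volume (sliceRegion h 0 d d t) = ENNReal.ofReal (|d| / 6) := by
  set G : ℝ → ℝ≥0∞ := fun r => (Icc (0:ℝ) 1).indicator (fun r => ENNReal.ofReal ((1 - r) * r)) r
    with hG
  have hF : (fun t => volume (sliceRegion h 0 d d t)) = fun t => G ((t - h) / d) := by
    funext t
    simp only [hG, Set.indicator_apply, mem_Icc]
    split_ifs with hr
    · exact volume_sliceRegion_rect h d t hd hr.2
    · rw [not_and_or, not_le, not_le] at hr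
      exact volume_sliceRegion_rect_eq_zero h d t hd hr
  rw [hF, lintegral_comp_sub_div G h d hd, hG,
    lintegral_indicator_Icc01 (fun r => (1 - r) * r) (by fun_prop)
      (fun r hr => mul_nonneg (by linarith [hr.2]) hr.1)]
  rw [← ENNReal.ofReal_mul (abs_nonneg d)]
  congr 1
  have : ∫ r in (0:ℝ)..1, (1 - r) * r = 1 / 6 := by
    have h1 : (fun r : ℝ => (1 - r) * r) = fun r => r - r ^ 2 := by funext r; ring
    rw [h1, intervalIntegral.integral_sub intervalIntegral.intervalIntegrable_id
      (intervalIntegral.intervalIntegrable_pow 2), integral_id, integral_pow]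
    norm_num
  rw [this]; ring

/-- the piecewise area function of the trapezoid class (plumbing). [folklore] -/
private def trapArea (t : ℝ) : ℝ := if t ≤ 1 / 2 then t - 3 / 2 * t ^ 2 else (1 - t) ^ 2 / 2

/-- it is continuous (the two pieces agree at `½`). [folklore] -/
private theorem trapArea_continuous : Continuous trapArea := by
  have h : trapArea = fun t => if t ≤ 1 / 2 then t - 3 / 2 * t ^ 2 else (1 - t) ^ 2 / 2 := rfl
  rw [h]
  refine Continuous.if_le (by fun_prop) (by fun_prop) continuous_id continuous_const ?_
  intro x hx
  rw [hx]; norm_num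

/-- **Trapezoid class, integrated over the level**: `∫ area(sliceRegion 0 1 0 ½ t) dt = 1/12`.
[cite: CohenRiesenfeldElber2001, §11.1 Example 11.2]; [cite: CurrySchoenberg1966, §4] -/
theorem lintegral_volume_sliceRegion_trapezoid :
    ∫⁻ t, volume (sliceRegion 0 1 0 (1 / 2) t) = ENNReal.ofReal (1 / 12) := by
  have hF : (fun t => volume (sliceRegion 0 1 0 (1 / 2) t)) =
      fun t => (Icc (0:ℝ) 1).indicator (fun t => ENNReal.ofReal (trapArea t)) t := by
    funext t
    simp only [Set.indicator_apply, mem_Icc, trapArea]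
    split_ifs with ht hle
    · exact volume_sliceRegion_trapezoid_low t ht.1 hle
    · exact volume_sliceRegion_trapezoid_high t (le_of_lt (not_le.mp hle)) ht.2
    · rw [not_and_or, not_le, not_le] at ht
      exact volume_sliceRegion_trapezoid_eq_zero t ht
  have hnn : ∀ r ∈ Icc (0:ℝ) 1, 0 ≤ trapArea r := by
    intro r hr
    simp only [trapArea]
    split_ifs with h
    · nlinarith [hr.1]
    · positivity
  rw [show (∫⁻ t, volume (sliceRegion 0 1 0 (1 / 2) t)) =
      ∫⁻ t, (fun t => volume (sliceRegion 0 1 0 (1 / 2) t)) t from rfl, hF,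
    lintegral_indicator_Icc01 trapArea trapArea_continuous hnn]
  congr 1
  -- split at `1/2`
  have hint : IntervalIntegrable trapArea volume (0:ℝ) 1 :=
    trapArea_continuous.intervalIntegrable _ _
  rw [← intervalIntegral.integral_add_adjacent_intervals (b := 1 / 2)
    (trapArea_continuous.intervalIntegrable _ _) (trapArea_continuous.intervalIntegrable _ _)]
  have h1 : ∫ t in (0:ℝ)..(1 / 2), trapArea t = ∫ t in (0:ℝ)..(1 / 2), (t - 3 / 2 * t ^ 2) := by
    refine intervalIntegral.integral_congr fun t ht => ?_
    rw [Set.uIcc_of_le (by norm_num)] at ht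
    simp only [trapArea, if_pos ht.2]
  have h2 : ∫ t in (1 / 2 : ℝ)..1, trapArea t = ∫ t in (1 / 2 : ℝ)..1, (1 - t) ^ 2 / 2 := by
    refine intervalIntegral.integral_congr fun t ht => ?_
    rw [Set.uIcc_of_le (by norm_num)] at ht
    by_cases hle : t ≤ 1 / 2
    · have : t = 1 / 2 := le_antisymm hle ht.1
      subst this
      simp only [trapArea, if_pos hle]
      norm_num
    · simp only [trapArea, if_neg hle]
  rw [h1, h2]
  have e1 : ∫ t in (0:ℝ)..(1 / 2), (t - 3 / 2 * t ^ 2) = 1 / 16 := by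
    rw [intervalIntegral.integral_sub intervalIntegral.intervalIntegrable_id
      ((intervalIntegral.intervalIntegrable_pow 2).const_mul _), integral_id,
      intervalIntegral.integral_const_mul, integral_pow]
    norm_num
  have e2 : ∫ t in (1 / 2 : ℝ)..1, (1 - t) ^ 2 / 2 = 1 / 48 := by
    have hsub := intervalIntegral.integral_comp_sub_left (fun r : ℝ => r ^ 2 / 2) (1 : ℝ)
      (a := 1 / 2) (b := 1)
    simp only [sub_self] at hsub
    rw [hsub, intervalIntegral.integral_div, integral_pow]
    norm_num
  rw [e1, e2]; norm_num

/-- Mirror class, integrated over the level. [cite: CohenRiesenfeldElber2001, §11.1 Example 11.2] -/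
theorem lintegral_volume_sliceRegion_mirror :
    ∫⁻ t, volume (sliceRegion 1 (-1) 0 (-1 / 2) t) = ENNReal.ofReal (1 / 12) := by
  simp_rw [sliceRegion_mirror]
  have h := lintegral_comp_sub_div (fun r => volume (sliceRegion 0 1 0 (1 / 2) r)) 1 (-1)
    (by norm_num)
  have hfun : (fun t => volume (sliceRegion 0 1 0 (1 / 2) (1 - t))) =
      fun t => (fun r => volume (sliceRegion 0 1 0 (1 / 2) r)) ((t - 1) / (-1)) := by
    funext t; congr 1; ring
  rw [hfun, h, lintegral_volume_sliceRegion_trapezoid]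
  norm_num

/-! ## Quadrature identities per class (Radau `{1/6, 1/2, 5/6; 3, 2, 3}` and Simpson `{0, ¼, ½, ¾, 1; 1, 4, 2, 4, 1}`)

The areas are polynomials of degree `≤ 2` on `[0, ½]` and on `[½, 1]`, so both composite rules are
exact: `Σ w_j · area(R(t_j)) = 8 · ∫ area` (Radau) and `= 12 · ∫ area` (Simpson).  Combined with
`volume_chartSlice_rogersSimplex` and `lintegral_volume_chartSlice_levelSet` they give, per cell `c`
of the class, `Σ w_j · area({f = t_j} ∩ c) = 8 ‖∇f_c‖ |c|` (resp. `12 ‖∇f_c‖ |c|`).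
[cite: CohenRiesenfeldElber2001, §11.1 Example 11.2 (the explicit quadratics)];
[cite: CurrySchoenberg1966, §4] -/

/-- `ℝ≥0∞` arithmetic for the Radau combination. [folklore] -/
private theorem ofReal_radau {a b c : ℝ} (ha : 0 ≤ a) (hb : 0 ≤ b) (hc : 0 ≤ c) :
    (3 : ℝ≥0∞) * ENNReal.ofReal a + 2 * ENNReal.ofReal b + 3 * ENNReal.ofReal c =
      ENNReal.ofReal (3 * a + 2 * b + 3 * c) := by
  rw [show (3 : ℝ≥0∞) = ENNReal.ofReal 3 by norm_num, show (2 : ℝ≥0∞) = ENNReal.ofReal 2 by norm_num,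
    ← ENNReal.ofReal_mul (by norm_num), ← ENNReal.ofReal_mul (by norm_num),
    ← ENNReal.ofReal_mul (by norm_num), ← ENNReal.ofReal_add (by positivity) (by positivity),
    ← ENNReal.ofReal_add (by positivity) (by positivity)]

/-- `ℝ≥0∞` arithmetic for the Simpson combination. [folklore] -/
private theorem ofReal_simpson {a b c d e : ℝ} (ha : 0 ≤ a) (hb : 0 ≤ b) (hc : 0 ≤ c) (hd : 0 ≤ d)
    (he : 0 ≤ e) :
    ENNReal.ofReal a + 4 * ENNReal.ofReal b + 2 * ENNReal.ofReal c + 4 * ENNReal.ofReal d +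
        ENNReal.ofReal e = ENNReal.ofReal (a + 4 * b + 2 * c + 4 * d + e) := by
  rw [show (4 : ℝ≥0∞) = ENNReal.ofReal 4 by norm_num, show (2 : ℝ≥0∞) = ENNReal.ofReal 2 by norm_num,
    ← ENNReal.ofReal_mul (by norm_num), ← ENNReal.ofReal_mul (by norm_num),
    ← ENNReal.ofReal_mul (by norm_num), ← ENNReal.ofReal_add (by positivity) (by positivity),
    ← ENNReal.ofReal_add (by positivity) (by positivity), ← ENNReal.ofReal_add (by positivity) (by positivity),
    ← ENNReal.ofReal_add (by positivity) (by positivity)]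

/-- **Radau identity**, class `(0; 0, 0, 1)` (`{0,0,0,1}`). [cite: CohenRiesenfeldElber2001, §11.1 Example 11.2] -/
theorem radau_sliceRegion_cone01 :
    (3 : ℝ≥0∞) * volume (sliceRegion 0 0 0 1 (1 / 6)) + 2 * volume (sliceRegion 0 0 0 1 (1 / 2)) +
        3 * volume (sliceRegion 0 0 0 1 (5 / 6)) = 8 * ∫⁻ t, volume (sliceRegion 0 0 0 1 t) := by
  rw [volume_sliceRegion_cone 0 1 (1 / 6) (by norm_num) (by norm_num),
    volume_sliceRegion_cone 0 1 (1 / 2) (by norm_num) (by norm_num),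
    volume_sliceRegion_cone 0 1 (5 / 6) (by norm_num) (by norm_num),
    lintegral_volume_sliceRegion_cone 0 1 (by norm_num)]
  rw [ofReal_radau (by norm_num) (by norm_num) (by norm_num),
    show (8 : ℝ≥0∞) = ENNReal.ofReal 8 by norm_num, ← ENNReal.ofReal_mul (by norm_num)]
  congr 1
  norm_num

/-- **Simpson identity**, class `(0; 0, 0, 1)` (`{0,0,0,1}`). [cite: CohenRiesenfeldElber2001, §11.1 Example 11.2] -/
theorem simpson_sliceRegion_cone01 :
    volume (sliceRegion 0 0 0 1 0) + 4 * volume (sliceRegion 0 0 0 1 (1 / 4)) + 2 * volume (sliceRegion 0 0 0 1 (1 / 2)) +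
        4 * volume (sliceRegion 0 0 0 1 (3 / 4)) + volume (sliceRegion 0 0 0 1 1) =
      12 * ∫⁻ t, volume (sliceRegion 0 0 0 1 t) := by
  rw [volume_sliceRegion_cone 0 1 0 (by norm_num) (by norm_num),
    volume_sliceRegion_cone 0 1 (1 / 4) (by norm_num) (by norm_num),
    volume_sliceRegion_cone 0 1 (1 / 2) (by norm_num) (by norm_num),
    volume_sliceRegion_cone 0 1 (3 / 4) (by norm_num) (by norm_num),
    volume_sliceRegion_cone 0 1 1 (by norm_num) (by norm_num),
    lintegral_volume_sliceRegion_cone 0 1 (by norm_num)]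
  rw [ofReal_simpson (by norm_num) (by norm_num) (by norm_num) (by norm_num) (by norm_num),
    show (12 : ℝ≥0∞) = ENNReal.ofReal 12 by norm_num, ← ENNReal.ofReal_mul (by norm_num)]
  congr 1
  norm_num

/-- **Radau identity**, class `(1; 0, 0, −1)` (`{0,1,1,1}`, rooted at a `1`-vertex). [cite: CohenRiesenfeldElber2001, §11.1 Example 11.2] -/
theorem radau_sliceRegion_cone10 :
    (3 : ℝ≥0∞) * volume (sliceRegion 1 0 0 (-1) (1 / 6)) + 2 * volume (sliceRegion 1 0 0 (-1) (1 / 2)) +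
        3 * volume (sliceRegion 1 0 0 (-1) (5 / 6)) = 8 * ∫⁻ t, volume (sliceRegion 1 0 0 (-1) t) := by
  rw [volume_sliceRegion_cone 1 (-1) (1 / 6) (by norm_num) (by norm_num),
    volume_sliceRegion_cone 1 (-1) (1 / 2) (by norm_num) (by norm_num),
    volume_sliceRegion_cone 1 (-1) (5 / 6) (by norm_num) (by norm_num),
    lintegral_volume_sliceRegion_cone 1 (-1) (by norm_num)]
  rw [ofReal_radau (by norm_num) (by norm_num) (by norm_num),
    show (8 : ℝ≥0∞) = ENNReal.ofReal 8 by norm_num, ← ENNReal.ofReal_mul (by norm_num)]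
  congr 1
  norm_num

/-- **Simpson identity**, class `(1; 0, 0, −1)` (`{0,1,1,1}`, rooted at a `1`-vertex). [cite: CohenRiesenfeldElber2001, §11.1 Example 11.2] -/
theorem simpson_sliceRegion_cone10 :
    volume (sliceRegion 1 0 0 (-1) 0) + 4 * volume (sliceRegion 1 0 0 (-1) (1 / 4)) + 2 * volume (sliceRegion 1 0 0 (-1) (1 / 2)) +
        4 * volume (sliceRegion 1 0 0 (-1) (3 / 4)) + volume (sliceRegion 1 0 0 (-1) 1) =
      12 * ∫⁻ t, volume (sliceRegion 1 0 0 (-1) t) := by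
  rw [volume_sliceRegion_cone 1 (-1) 0 (by norm_num) (by norm_num),
    volume_sliceRegion_cone 1 (-1) (1 / 4) (by norm_num) (by norm_num),
    volume_sliceRegion_cone 1 (-1) (1 / 2) (by norm_num) (by norm_num),
    volume_sliceRegion_cone 1 (-1) (3 / 4) (by norm_num) (by norm_num),
    volume_sliceRegion_cone 1 (-1) 1 (by norm_num) (by norm_num),
    lintegral_volume_sliceRegion_cone 1 (-1) (by norm_num)]
  rw [ofReal_simpson (by norm_num) (by norm_num) (by norm_num) (by norm_num) (by norm_num),
    show (12 : ℝ≥0∞) = ENNReal.ofReal 12 by norm_num, ← ENNReal.ofReal_mul (by norm_num)]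
  congr 1
  norm_num

/-- **Radau identity**, class `(0; 0, 0, ½)` (`{½; 0,0,0}`). [cite: CohenRiesenfeldElber2001, §11.1 Example 11.2] -/
theorem radau_sliceRegion_cone0h :
    (3 : ℝ≥0∞) * volume (sliceRegion 0 0 0 (1 / 2) (1 / 6)) + 2 * volume (sliceRegion 0 0 0 (1 / 2) (1 / 2)) +
        3 * volume (sliceRegion 0 0 0 (1 / 2) (5 / 6)) = 8 * ∫⁻ t, volume (sliceRegion 0 0 0 (1 / 2) t) := by
  rw [volume_sliceRegion_cone 0 (1 / 2) (1 / 6) (by norm_num) (by norm_num),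
    volume_sliceRegion_cone 0 (1 / 2) (1 / 2) (by norm_num) (by norm_num),
    volume_sliceRegion_cone_eq_zero 0 (1 / 2) (5 / 6) (by norm_num),
    lintegral_volume_sliceRegion_cone 0 (1 / 2) (by norm_num)]
  rw [← ENNReal.ofReal_zero]
  rw [ofReal_radau (by norm_num) (by norm_num) (by norm_num),
    show (8 : ℝ≥0∞) = ENNReal.ofReal 8 by norm_num, ← ENNReal.ofReal_mul (by norm_num)]
  congr 1
  norm_num

/-- **Simpson identity**, class `(0; 0, 0, ½)` (`{½; 0,0,0}`). [cite: CohenRiesenfeldElber2001, §11.1 Example 11.2] -/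
theorem simpson_sliceRegion_cone0h :
    volume (sliceRegion 0 0 0 (1 / 2) 0) + 4 * volume (sliceRegion 0 0 0 (1 / 2) (1 / 4)) + 2 * volume (sliceRegion 0 0 0 (1 / 2) (1 / 2)) +
        4 * volume (sliceRegion 0 0 0 (1 / 2) (3 / 4)) + volume (sliceRegion 0 0 0 (1 / 2) 1) =
      12 * ∫⁻ t, volume (sliceRegion 0 0 0 (1 / 2) t) := by
  rw [volume_sliceRegion_cone 0 (1 / 2) 0 (by norm_num) (by norm_num),
    volume_sliceRegion_cone 0 (1 / 2) (1 / 4) (by norm_num) (by norm_num),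
    volume_sliceRegion_cone 0 (1 / 2) (1 / 2) (by norm_num) (by norm_num),
    volume_sliceRegion_cone_eq_zero 0 (1 / 2) (3 / 4) (by norm_num),
    volume_sliceRegion_cone_eq_zero 0 (1 / 2) 1 (by norm_num),
    lintegral_volume_sliceRegion_cone 0 (1 / 2) (by norm_num)]
  rw [← ENNReal.ofReal_zero]
  rw [ofReal_simpson (by norm_num) (by norm_num) (by norm_num) (by norm_num) (by norm_num),
    show (12 : ℝ≥0∞) = ENNReal.ofReal 12 by norm_num, ← ENNReal.ofReal_mul (by norm_num)]
  congr 1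
  norm_num

/-- **Radau identity**, class `(1; 0, 0, −½)` (`{½; 1,1,1}`). [cite: CohenRiesenfeldElber2001, §11.1 Example 11.2] -/
theorem radau_sliceRegion_cone1h :
    (3 : ℝ≥0∞) * volume (sliceRegion 1 0 0 (-1 / 2) (1 / 6)) + 2 * volume (sliceRegion 1 0 0 (-1 / 2) (1 / 2)) +
        3 * volume (sliceRegion 1 0 0 (-1 / 2) (5 / 6)) = 8 * ∫⁻ t, volume (sliceRegion 1 0 0 (-1 / 2) t) := by
  rw [volume_sliceRegion_cone_eq_zero 1 (-1 / 2) (1 / 6) (by norm_num),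
    volume_sliceRegion_cone 1 (-1 / 2) (1 / 2) (by norm_num) (by norm_num),
    volume_sliceRegion_cone 1 (-1 / 2) (5 / 6) (by norm_num) (by norm_num),
    lintegral_volume_sliceRegion_cone 1 (-1 / 2) (by norm_num)]
  rw [← ENNReal.ofReal_zero]
  rw [ofReal_radau (by norm_num) (by norm_num) (by norm_num),
    show (8 : ℝ≥0∞) = ENNReal.ofReal 8 by norm_num, ← ENNReal.ofReal_mul (by norm_num)]
  congr 1
  norm_num

/-- **Simpson identity**, class `(1; 0, 0, −½)` (`{½; 1,1,1}`). [cite: CohenRiesenfeldElber2001, §11.1 Example 11.2] -/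
theorem simpson_sliceRegion_cone1h :
    volume (sliceRegion 1 0 0 (-1 / 2) 0) + 4 * volume (sliceRegion 1 0 0 (-1 / 2) (1 / 4)) + 2 * volume (sliceRegion 1 0 0 (-1 / 2) (1 / 2)) +
        4 * volume (sliceRegion 1 0 0 (-1 / 2) (3 / 4)) + volume (sliceRegion 1 0 0 (-1 / 2) 1) =
      12 * ∫⁻ t, volume (sliceRegion 1 0 0 (-1 / 2) t) := by
  rw [volume_sliceRegion_cone_eq_zero 1 (-1 / 2) 0 (by norm_num),
    volume_sliceRegion_cone_eq_zero 1 (-1 / 2) (1 / 4) (by norm_num),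
    volume_sliceRegion_cone 1 (-1 / 2) (1 / 2) (by norm_num) (by norm_num),
    volume_sliceRegion_cone 1 (-1 / 2) (3 / 4) (by norm_num) (by norm_num),
    volume_sliceRegion_cone 1 (-1 / 2) 1 (by norm_num) (by norm_num),
    lintegral_volume_sliceRegion_cone 1 (-1 / 2) (by norm_num)]
  rw [← ENNReal.ofReal_zero]
  rw [ofReal_simpson (by norm_num) (by norm_num) (by norm_num) (by norm_num) (by norm_num),
    show (12 : ℝ≥0∞) = ENNReal.ofReal 12 by norm_num, ← ENNReal.ofReal_mul (by norm_num)]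
  congr 1
  norm_num

/-- **Radau identity**, class `(0; 0, 1, 1)` (`{0,0,1,1}`). [cite: CohenRiesenfeldElber2001, §11.1 Example 11.2] -/
theorem radau_sliceRegion_rect01 :
    (3 : ℝ≥0∞) * volume (sliceRegion 0 0 1 1 (1 / 6)) + 2 * volume (sliceRegion 0 0 1 1 (1 / 2)) +
        3 * volume (sliceRegion 0 0 1 1 (5 / 6)) = 8 * ∫⁻ t, volume (sliceRegion 0 0 1 1 t) := by
  rw [volume_sliceRegion_rect 0 1 (1 / 6) (by norm_num) (by norm_num),
    volume_sliceRegion_rect 0 1 (1 / 2) (by norm_num) (by norm_num),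
    volume_sliceRegion_rect 0 1 (5 / 6) (by norm_num) (by norm_num),
    lintegral_volume_sliceRegion_rect 0 1 (by norm_num)]
  rw [ofReal_radau (by norm_num) (by norm_num) (by norm_num),
    show (8 : ℝ≥0∞) = ENNReal.ofReal 8 by norm_num, ← ENNReal.ofReal_mul (by norm_num)]
  congr 1
  norm_num

/-- **Simpson identity**, class `(0; 0, 1, 1)` (`{0,0,1,1}`). [cite: CohenRiesenfeldElber2001, §11.1 Example 11.2] -/
theorem simpson_sliceRegion_rect01 :
    volume (sliceRegion 0 0 1 1 0) + 4 * volume (sliceRegion 0 0 1 1 (1 / 4)) + 2 * volume (sliceRegion 0 0 1 1 (1 / 2)) +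
        4 * volume (sliceRegion 0 0 1 1 (3 / 4)) + volume (sliceRegion 0 0 1 1 1) =
      12 * ∫⁻ t, volume (sliceRegion 0 0 1 1 t) := by
  rw [volume_sliceRegion_rect 0 1 0 (by norm_num) (by norm_num),
    volume_sliceRegion_rect 0 1 (1 / 4) (by norm_num) (by norm_num),
    volume_sliceRegion_rect 0 1 (1 / 2) (by norm_num) (by norm_num),
    volume_sliceRegion_rect 0 1 (3 / 4) (by norm_num) (by norm_num),
    volume_sliceRegion_rect 0 1 1 (by norm_num) (by norm_num),
    lintegral_volume_sliceRegion_rect 0 1 (by norm_num)]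
  rw [ofReal_simpson (by norm_num) (by norm_num) (by norm_num) (by norm_num) (by norm_num),
    show (12 : ℝ≥0∞) = ENNReal.ofReal 12 by norm_num, ← ENNReal.ofReal_mul (by norm_num)]
  congr 1
  norm_num

/-- **Radau identity**, class `(0; 1, 0, ½)` (`{½; 0,0,1}` rooted at a `0`-vertex). [cite: CohenRiesenfeldElber2001, §11.1 Example 11.2] -/
theorem radau_sliceRegion_trapezoid :
    (3 : ℝ≥0∞) * volume (sliceRegion 0 1 0 (1 / 2) (1 / 6)) + 2 * volume (sliceRegion 0 1 0 (1 / 2) (1 / 2)) +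
        3 * volume (sliceRegion 0 1 0 (1 / 2) (5 / 6)) = 8 * ∫⁻ t, volume (sliceRegion 0 1 0 (1 / 2) t) := by
  rw [volume_sliceRegion_trapezoid_low (1 / 6) (by norm_num) (by norm_num),
    volume_sliceRegion_trapezoid_low (1 / 2) (by norm_num) (by norm_num),
    volume_sliceRegion_trapezoid_high (5 / 6) (by norm_num) (by norm_num),
    lintegral_volume_sliceRegion_trapezoid]
  rw [ofReal_radau (by norm_num) (by norm_num) (by norm_num),
    show (8 : ℝ≥0∞) = ENNReal.ofReal 8 by norm_num, ← ENNReal.ofReal_mul (by norm_num)]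
  congr 1
  norm_num

/-- **Simpson identity**, class `(0; 1, 0, ½)` (`{½; 0,0,1}` rooted at a `0`-vertex). [cite: CohenRiesenfeldElber2001, §11.1 Example 11.2] -/
theorem simpson_sliceRegion_trapezoid :
    volume (sliceRegion 0 1 0 (1 / 2) 0) + 4 * volume (sliceRegion 0 1 0 (1 / 2) (1 / 4)) + 2 * volume (sliceRegion 0 1 0 (1 / 2) (1 / 2)) +
        4 * volume (sliceRegion 0 1 0 (1 / 2) (3 / 4)) + volume (sliceRegion 0 1 0 (1 / 2) 1) =
      12 * ∫⁻ t, volume (sliceRegion 0 1 0 (1 / 2) t) := by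
  rw [volume_sliceRegion_trapezoid_low 0 (by norm_num) (by norm_num),
    volume_sliceRegion_trapezoid_low (1 / 4) (by norm_num) (by norm_num),
    volume_sliceRegion_trapezoid_low (1 / 2) (by norm_num) (by norm_num),
    volume_sliceRegion_trapezoid_high (3 / 4) (by norm_num) (by norm_num),
    volume_sliceRegion_trapezoid_high 1 (by norm_num) (by norm_num),
    lintegral_volume_sliceRegion_trapezoid]
  rw [ofReal_simpson (by norm_num) (by norm_num) (by norm_num) (by norm_num) (by norm_num),
    show (12 : ℝ≥0∞) = ENNReal.ofReal 12 by norm_num, ← ENNReal.ofReal_mul (by norm_num)]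
  congr 1
  norm_num

/-- **Radau identity**, class `(1; −1, 0, −½)` (`{½; 0,1,1}` rooted at a `1`-vertex). [cite: CohenRiesenfeldElber2001, §11.1 Example 11.2] -/
theorem radau_sliceRegion_mirror :
    (3 : ℝ≥0∞) * volume (sliceRegion 1 (-1) 0 (-1 / 2) (1 / 6)) + 2 * volume (sliceRegion 1 (-1) 0 (-1 / 2) (1 / 2)) +
        3 * volume (sliceRegion 1 (-1) 0 (-1 / 2) (5 / 6)) = 8 * ∫⁻ t, volume (sliceRegion 1 (-1) 0 (-1 / 2) t) := by
  rw [lintegral_volume_sliceRegion_mirror]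
  simp only [sliceRegion_mirror]
  rw [volume_sliceRegion_trapezoid_high (1 - (1 / 6)) (by norm_num) (by norm_num),
    volume_sliceRegion_trapezoid_low (1 - (1 / 2)) (by norm_num) (by norm_num),
    volume_sliceRegion_trapezoid_low (1 - (5 / 6)) (by norm_num) (by norm_num)]
  rw [ofReal_radau (by norm_num) (by norm_num) (by norm_num),
    show (8 : ℝ≥0∞) = ENNReal.ofReal 8 by norm_num, ← ENNReal.ofReal_mul (by norm_num)]
  congr 1
  norm_num

/-- **Simpson identity**, class `(1; −1, 0, −½)` (`{½; 0,1,1}` rooted at a `1`-vertex). [cite: CohenRiesenfeldElber2001, §11.1 Example 11.2] -/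
theorem simpson_sliceRegion_mirror :
    volume (sliceRegion 1 (-1) 0 (-1 / 2) 0) + 4 * volume (sliceRegion 1 (-1) 0 (-1 / 2) (1 / 4)) + 2 * volume (sliceRegion 1 (-1) 0 (-1 / 2) (1 / 2)) +
        4 * volume (sliceRegion 1 (-1) 0 (-1 / 2) (3 / 4)) + volume (sliceRegion 1 (-1) 0 (-1 / 2) 1) =
      12 * ∫⁻ t, volume (sliceRegion 1 (-1) 0 (-1 / 2) t) := by
  rw [lintegral_volume_sliceRegion_mirror]
  simp only [sliceRegion_mirror]
  rw [volume_sliceRegion_trapezoid_high (1 - 0) (by norm_num) (by norm_num),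
    volume_sliceRegion_trapezoid_high (1 - (1 / 4)) (by norm_num) (by norm_num),
    volume_sliceRegion_trapezoid_low (1 - (1 / 2)) (by norm_num) (by norm_num),
    volume_sliceRegion_trapezoid_low (1 - (3 / 4)) (by norm_num) (by norm_num),
    volume_sliceRegion_trapezoid_low (1 - 1) (by norm_num) (by norm_num)]
  rw [ofReal_simpson (by norm_num) (by norm_num) (by norm_num) (by norm_num) (by norm_num),
    show (12 : ℝ≥0∞) = ENNReal.ofReal 12 by norm_num, ← ENNReal.ofReal_mul (by norm_num)]
  congr 1
  norm_num

/-! ## H-description of `rogersSimplex v c` through a dual frame (glue to open H-polytope cells) -/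

/-- **H-description of a simplex through a dual frame.**  If `⟪wᵢ, cⱼ⟫ = δᵢⱼ` then
`rogersSimplex v c = {x | 0 ≤ ⟪wᵢ, x − v⟫ (i = 0,1,2), Σᵢ ⟪wᵢ, x − v⟫ ≤ 1}` — the barycentric
coordinates `sᵢ = ⟪wᵢ, x − v⟫` are read off by the dual vectors, so the closed simplex is the
intersection of four closed half-spaces with normals `−w₀, −w₁, −w₂, w₀ + w₁ + w₂`.
[cite: Rogers1964, Ch. 7 §2 (the simplices `c₀c₁c₂c₃`)] -/
theorem rogersSimplex_eq_setOf_dual (v : EuclideanSpace ℝ (Fin 3)) (c w : Fin 3 → EuclideanSpace ℝ (Fin 3))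
    (hw : ∀ i j, ⟪w i, c j⟫ = if i = j then (1 : ℝ) else 0) :
    rogersSimplex v c = {x | (∀ i, 0 ≤ ⟪w i, x - v⟫) ∧ ∑ i, ⟪w i, x - v⟫ ≤ 1} := by
  -- pairing a combination with `w i` returns the `i`-th coefficient
  have hpair : ∀ (i : Fin 3) (s : Fin 3 → ℝ), ⟪w i, ∑ j, s j • c j⟫ = s i := by
    intro i s
    rw [inner_sum]
    simp_rw [inner_smul_right, hw]
    simp
  -- `c` is linearly independent, hence spans
  have hli : LinearIndependent ℝ c := by
    rw [Fintype.linearIndependent_iff]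
    intro s hs i
    have := hpair i s
    rw [hs, inner_zero_right] at this
    exact this.symm
  have hspan : ∀ z : EuclideanSpace ℝ (Fin 3), ∃ s : Fin 3 → ℝ, ∑ j, s j • c j = z := by
    intro z
    have htop : Submodule.span ℝ (Set.range c) = ⊤ :=
      hli.span_eq_top_of_card_eq_finrank (by simp)
    have hz : z ∈ Submodule.span ℝ (Set.range c) := by rw [htop]; exact Submodule.mem_top
    exact Submodule.mem_span_range_iff_exists_fun ℝ |>.mp hz
  ext x
  rw [mem_rogersSimplex_iff]
  simp only [Set.mem_setOf_eq]
  constructor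
  · rintro ⟨s₀, s₁, s₂, h0, h1, h2, hs, rfl⟩
    have hx : v + s₀ • c 0 + s₁ • c 1 + s₂ • c 2 - v = ∑ j, (![s₀, s₁, s₂] : Fin 3 → ℝ) j • c j := by
      simp only [Fin.sum_univ_three, Matrix.cons_val_zero, Matrix.cons_val_one, Matrix.cons_val]
      abel
    rw [hx]
    simp_rw [hpair]
    refine ⟨fun i => ?_, ?_⟩
    · fin_cases i <;> simp [h0, h1, h2]
    · simp only [Fin.sum_univ_three, Matrix.cons_val_zero, Matrix.cons_val_one, Matrix.cons_val]
      exact hs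
  · rintro ⟨hpos, hsum⟩
    obtain ⟨s, hs⟩ := hspan (x - v)
    have hsi : ∀ i, ⟪w i, x - v⟫ = s i := fun i => by rw [← hs, hpair]
    refine ⟨s 0, s 1, s 2, ?_, ?_, ?_, ?_, ?_⟩
    · rw [← hsi]; exact hpos 0
    · rw [← hsi]; exact hpos 1
    · rw [← hsi]; exact hpos 2
    · have := hsum; simp only [Fin.sum_univ_three, hsi] at this; exact this
    · have hx : x = v + (x - v) := by abel
      rw [hx, ← hs]
      simp only [Fin.sum_univ_three]
      abel

/-- The open version: with a dual frame, the points with strictly positive barycentric coordinates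
`{x | 0 < ⟪wᵢ, x − v⟫, Σᵢ ⟪wᵢ, x − v⟫ < 1}` lie in `rogersSimplex v c` (they form its interior when the
simplex is nondegenerate).  [cite: Rogers1964, Ch. 7 §2] -/
theorem setOf_dual_lt_subset_rogersSimplex (v : EuclideanSpace ℝ (Fin 3))
    (c w : Fin 3 → EuclideanSpace ℝ (Fin 3)) (hw : ∀ i j, ⟪w i, c j⟫ = if i = j then (1 : ℝ) else 0) :
    {x | (∀ i, 0 < ⟪w i, x - v⟫) ∧ ∑ i, ⟪w i, x - v⟫ < 1} ⊆ rogersSimplex v c := by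
  rw [rogersSimplex_eq_setOf_dual v c w hw]
  rintro x ⟨hpos, hsum⟩
  exact ⟨fun i => (hpos i).le, hsum.le⟩


end Literature.Analysis.Convexity
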